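import Summits.CriticalPhenomena.PercolationContinuityZ3.Theorems.PercNearOneGluingNoHeavyLowerTailCubicThreePointTerminalClosure
import Mathlib.Tactic.Ring
import Mathlib.Tactic.Linarith
import Mathlib.Tactic.Positivity
import HarnessLib

/-!
# `NoHeavyLowerTail` (stmt-CriticalPhenomena-4575) — hub-edge certificate, Gladkov's form `AG` on the segment

Support file (prover prim-gen-kcluster gen 10, k-cluster line; `--supports stmt-CriticalPhenomena-4575`).  Pure polynomial algebra over `ℝ`;
no definitions, no named facts, no sorries.  Companion of the seven `…CubicThreePointHubEdge{C0,C1,C2,D0,D1,D2,D3}` certificate pieces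
(assembled in `…CubicThreePointHubEdge`).  For the hub-edge family `L_p = (1−p)·w + p·z` (`w = x ⊙ y` two stars in parallel = `K_{2,3}`,
`z` the merged star, `p` the hub–hub edge probability) the quadratic form `AG = qt − e₂(u)` is, in the box variables `x, x' = 1 − x`
(here including `p, p' = 1 − p`), a polynomial with NONNEGATIVE INTEGER coefficients (`hubEdge_AG`, 189 monomials, identity in the free
ring), hence `AG(L_p) ≥ 0` on the box (`hubEdge_AG_nonneg`).  Also here: the Bernstein form of a cubic form along a segment of cell vectors
(`Ha_segment_bernstein`, `Hb_segment_bernstein`) and the recombination identities (`segment_recombine`, `segment_recombine₃`) used by the assembly.  For realizable laws this is Gladkov's theorem (tree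
`prodBernoulli_threePoint_strongHarris`); the point of the certificate is that the ABSTRACT cell vector `L_p` satisfies it, which is what
the K3-semigroup theorem `maxH_join_nonneg` consumes.  Memo: run/shared/lean/prim/prim-gen-kcluster/KCLUSTER-gen10.md §3.
[cite: Gladkov2024StrongFKG, Cor. 4.2]
-/

namespace Summit.CriticalPhenomena.PercolationContinuityZ3.Theorems

namespace CubicThreePointHub

open CubicThreePointTerminal

set_option maxRecDepth 16384 in
set_option maxHeartbeats 4000000 in
/-- `AG(L_p)` in the free box variables: a polynomial with nonnegative integer coefficients. [cite: Gladkov2024StrongFKG, Cor. 4.2] -/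
theorem hubEdge_AG {p p' a a' b b' c c' A A' B B' C C' ma na mb nb mc nc qw w₁ w₂ w₃ tw qz z₁ z₂ z₃ tz q u₁ u₂ u₃ t : ℝ}
    (hqw : qw = (a' * b' * c' + a * b' * c' + a' * b * c' + a' * b' * c) * (A' * B' * C' + A * B' * C' + A' * B * C' + A' * B' * C))
    (hw₁ : w₁ = (a' * b' * c' + a * b' * c' + a' * b * c' + a' * b' * c) * (A * B * C') + a * b * c' * (A' * B' * C' + A * B' * C' + A' * B * C'
        + A' * B' * C) + a * b * c' * (A * B * C'))
    (hw₂ : w₂ = (a' * b' * c' + a * b' * c' + a' * b * c' + a' * b' * c) * (A * C * B') + a * c * b' * (A' * B' * C' + A * B' * C' + A' * B * C'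
        + A' * B' * C) + a * c * b' * (A * C * B'))
    (hw₃ : w₃ = (a' * b' * c' + a * b' * c' + a' * b * c' + a' * b' * c) * (B * C * A') + b * c * a' * (A' * B' * C' + A * B' * C' + A' * B * C'
        + A' * B' * C) + b * c * a' * (B * C * A'))
    (htw : tw = a * b * c * ((A' * B' * C' + A * B' * C' + A' * B * C' + A' * B' * C) + A * B * C' + A * C * B' + B * C * A' + A * B * C)
        + A * B * C * ((a' * b' * c' + a * b' * c' + a' * b * c' + a' * b' * c) + a * b * c' + a * c * b' + b * c * a')
       
        + (a * b * c' * (A * C * B' + B * C * A') + a * c * b' * (A * B * C' + B * C * A') + b * c * a' * (A * B * C' + A * C * B')))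
    (hma : ma = a * A + a * A' + a' * A) (hna : na = a' * A') (hmb : mb = b * B + b * B' + b' * B) (hnb : nb = b' * B')
    (hmc : mc = c * C + c * C' + c' * C) (hnc : nc = c' * C')
    (hqz : qz = (na * nb * nc + ma * nb * nc + na * mb * nc + na * nb * mc)) (hz₁ : z₁ = ma * mb * nc) (hz₂ : z₂ = ma * mc * nb)
    (hz₃ : z₃ = mb * mc * na) (htz : tz = ma * mb * mc)
    (hq : q = p' * qw + p * qz) (hu₁ : u₁ = p' * w₁ + p * z₁) (hu₂ : u₂ = p' * w₂ + p * z₂) (hu₃ : u₃ = p' * w₃ + p * z₃)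
    (ht : t = p' * tw + p * tz) :
    AG q u₁ u₂ u₃ t
    = (p' * p' * ((a' * a' * ((b' * b' * (c' * c' * (A * (A' * (B * (B' * (C * (C')))))) + c * (c' * (A * (A' * (B * (B' * (C * (2 * C')))))))
      + c * c * (A * (A' * (B * (B' * (C * (C')))))))) + b * (b' * (c' * c' * (A * (A' * (B * (B' * (C * (2 * C'))))))
      + c * (c' * (A * (A' * (B * (B' * (C * (3 * C'))))) + A * A * (B * (B' * (C * (C')))))) + c * c * ((A * (A' * (B * (B' * (C * (C')))))
      + A * A * (B * (B' * (C * (C')))))))) + b * b * ((c' * c' * (A * (A' * (B * (B' * (C * (C')))))) + c * (c' * (A * (A' * (B * (B' * (C * (C')))))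
      + A * A * (B * (B' * (C * (C')))))))))) + a * (a' * ((b' * b' * (c' * c' * (A * (A' * (B * (B' * (C * (2 * C'))))))
      + c * (c' * (A * (A' * (B * (B' * (C * (3 * C'))) + B * B * (C * (C')))))) + c * c * ((A * (A' * (B * (B' * (C * (C'))) + B * B * (C * (C'))))))))
      + b * (b' * ((c' * c' * (A * (A' * (B * (B' * (C * (3 * C') + C * C)))))) + c * (c' * ((A' * A' * ((B' * B' * (C' * C' + C * (2 * C') + C * C))
      + B * (B' * (2 * C' * C' + C * (3 * C') + C * C)) + B * B * ((C' * C' + C * (C'))))) + A * (A' * ((B' * B' * (2 * C' * C' + C * (3 * C') + C * C))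
      + B * (B' * (3 * C' * C' + C * (7 * C') + 2 * C * C)) + B * B * ((C' * C' + C * (2 * C'))))) + A * A * (((B' * B' * (C' * C' + C * (C')))
      + B * (B' * (C' * C' + C * (2 * C'))))))) + c * c * ((A * (A' * (B * (B' * (C' * C' + C * (2 * C'))) + B * B * ((C' * C' + C * (C')))))
      + A * A * ((B * (B' * (C' * C' + C * (C'))))))))) + b * b * (((c' * c' * (A * (A' * (B * (B' * (C * (C') + C * C))))))
      + c * (c' * (A * (A' * ((B' * B' * (C * (C') + C * C)) + B * (B' * (C * (2 * C') + C * C)))) + A * A * ((B' * B' * (C * (C'))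
      + B * (B' * (C * (C'))))))))))) + a * a * (((b' * b' * (c' * c' * (A * (A' * (B * (B' * (C * (C')))))) + c * (c' * (A * (A' * (B * (B' * (C * (C')))
      + B * B * (C * (C')))))))) + b * (b' * ((c' * c' * (A * (A' * (B * (B' * (C * (C') + C * C)))))) + c * (c' * ((A' * A' * (B * (B' * (C * (C') + C * C))
      + B * B * (C * (C')))) + A * (A' * (B * (B' * (C * (2 * C') + C * C)) + B * B * (C * (C'))))))))))))
      + p * (p' * ((a' * a' * ((b' * b' * (c' * c' * (A * (A' * (B * (B' * (C * (2 * C')))))) + c * (c' * (A * (A' * (B * (B' * (C' * C' + C * (3 * C')))))))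
      + c * c * ((A * (A' * (B * (B' * (C' * C' + C * (C'))))))))) + b * (b' * ((c' * c' * (A * (A' * (B' * B' * (C * (C')) + B * (B' * (C * (3 * C')))))))
      + c * (c' * (A * (A' * ((B' * B' * (C' * C' + C * (2 * C'))) + B * (B' * (2 * C' * C' + C * (4 * C'))))) + A * A * (((B' * B' * (C' * C' + C * (C')))
      + B * (B' * (C' * C' + C * (2 * C'))))))) + c * c * ((A * (A' * (B * (B' * (C' * C' + C * (C'))))) + A * A * ((B * (B' * (C' * C' + C * (C')))))))))
      + b * b * (((c' * c' * (A * (A' * (B' * B' * (C * (C')) + B * (B' * (C * (C'))))))) + c * (c' * (A * (A' * (B' * B' * (C * (C'))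
      + B * (B' * (C * (C'))))) + A * A * ((B' * B' * (C * (C')) + B * (B' * (C * (C')))))))))))
      + a * (a' * ((b' * b' * ((c' * c' * (A' * A' * (B * (B' * (C * (C')))) + A * (A' * (B * (B' * (C * (3 * C')))))))
      + c * (c' * ((A' * A' * (B * (B' * (C' * C' + C * (2 * C'))) + B * B * ((C' * C' + C * (C'))))) + A * (A' * (B * (B' * (2 * C' * C' + C * (4 * C')))
      + B * B * ((C' * C' + C * (2 * C'))))))) + c * c * ((A * (A' * (B * (B' * (C' * C' + C * (C'))) + B * B * ((C' * C' + C * (C')))))))))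
      + b * (b' * ((c' * c' * ((A' * A' * ((B' * B' * (C * (C') + C * C)) + B * (B' * (C * (2 * C') + C * C)))) + A * (A' * ((B' * B' * (C * (2 * C')
      + C * C)) + B * (B' * (C * (4 * C') + 2 * C * C)))))) + c * (c' * ((A' * A' * ((B' * B' * (2 * C' * C' + C * (3 * C') + C * C)) + B * (B' * (3 * C' * C'
      + C * (4 * C') + C * C)) + B * B * ((C' * C' + C * (C'))))) + A * (A' * ((B' * B' * (3 * C' * C' + C * (4 * C') + C * C)) + B * (B' * (4 * C' * C'
      + C * (8 * C') + 2 * C * C)) + B * B * ((C' * C' + C * (2 * C'))))) + A * A * (((B' * B' * (C' * C' + C * (C'))) + B * (B' * (C' * C'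
      + C * (2 * C'))))))) + c * c * ((A * (A' * (B * (B' * (2 * C' * C' + C * (2 * C'))) + B * B * ((C' * C' + C * (C'))))) + A * A * ((B * (B' * (C' * C'
      + C * (C'))))))))) + b * b * (((c' * c' * (A * (A' * ((B' * B' * (C * (C') + C * C)) + B * (B' * (C * (C') + C * C))))))
      + c * (c' * (A * (A' * ((B' * B' * (C * (2 * C') + C * C)) + B * (B' * (C * (2 * C') + C * C)))) + A * A * ((B' * B' * (C * (C'))
      + B * (B' * (C * (C'))))))))))) + a * a * (((b' * b' * ((c' * c' * (A' * A' * (B * (B' * (C * (C')))) + A * (A' * (B * (B' * (C * (C')))))))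
      + c * (c' * ((A' * A' * (B * (B' * (C * (C'))) + B * B * (C * (C')))) + A * (A' * (B * (B' * (C * (C'))) + B * B * (C * (C'))))))))
      + b * (b' * ((c' * c' * ((A' * A' * (B * (B' * (C * (C') + C * C)))) + A * (A' * (B * (B' * (C * (C') + C * C))))))
      + c * (c' * ((A' * A' * (B * (B' * (C * (2 * C') + C * C)) + B * B * (C * (C')))) + A * (A' * (B * (B' * (C * (2 * C') + C * C))
      + B * B * (C * (C')))))))))))) + p * p * (((a' * a' * ((b' * b' * (c' * c' * (A * (A' * (B * (B' * (C * (C'))))))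
      + c * (c' * (A * (A' * (B * (B' * (C' * C' + C * (C'))))))))) + b * (b' * ((c' * c' * (A * (A' * (B' * B' * (C * (C')) + B * (B' * (C * (C')))))))
      + c * (c' * (A * (A' * ((B' * B' * (C' * C' + C * (C'))) + B * (B' * (C' * C' + C * (C')))))))))))
      + a * (a' * ((b' * b' * ((c' * c' * (A' * A' * (B * (B' * (C * (C')))) + A * (A' * (B * (B' * (C * (C')))))))
      + c * (c' * ((A' * A' * (B * (B' * (C' * C' + C * (C'))))) + A * (A' * (B * (B' * (C' * C' + C * (C')))))))))
      + b * (b' * ((c' * c' * ((A' * A' * (B' * B' * (C * (C')) + B * (B' * (C * (C'))))) + A * (A' * (B' * B' * (C * (C')) + B * (B' * (C * (C')))))))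
      + c * (c' * ((A' * A' * ((B' * B' * (C' * C' + C * (C'))) + B * (B' * (C' * C' + C * (C'))))) + A * (A' * ((B' * B' * (C' * C' + C * (C')))
      + B * (B' * (C' * C' + C * (C'))))))))))))) := by
  subst hqw hw₁ hw₂ hw₃ htw hma hna hmb hnb hmc hnc hqz hz₁ hz₂ hz₃ htz hq hu₁ hu₂ hu₃ ht
  simp only [AG]
  ring

set_option maxRecDepth 16384 in
set_option maxHeartbeats 4000000 in
/-- `AG ≥ 0` on the hub-edge family (cells in the tree's star / parallel-composition form, hub edge `p ∈ [0,1]`). [cite: Gladkov2024StrongFKG, Cor. 4.2] -/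
theorem hubEdge_AG_nonneg {p a b c A B C qw w₁ w₂ w₃ tw qz z₁ z₂ z₃ tz q u₁ u₂ u₃ t : ℝ}
    (hp₀ : 0 ≤ p) (hp₁ : p ≤ 1) (ha₀ : 0 ≤ a) (ha₁ : a ≤ 1) (hb₀ : 0 ≤ b) (hb₁ : b ≤ 1) (hc₀ : 0 ≤ c) (hc₁ : c ≤ 1)
    (hA₀ : 0 ≤ A) (hA₁ : A ≤ 1) (hB₀ : 0 ≤ B) (hB₁ : B ≤ 1) (hC₀ : 0 ≤ C) (hC₁ : C ≤ 1)
    (hqw : qw = (1 - (a * b + a * c + b * c) + 2 * (a * b * c)) * (1 - (A * B + A * C + B * C) + 2 * (A * B * C)))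
    (hw₁ : w₁ = (1 - (a * b + a * c + b * c) + 2 * (a * b * c)) * (A * B * (1 - C)) + a * b * (1 - c) * (1 - (A * B + A * C + B * C) + 2 * (A * B * C))
        + a * b * (1 - c) * (A * B * (1 - C)))
    (hw₂ : w₂ = (1 - (a * b + a * c + b * c) + 2 * (a * b * c)) * (A * C * (1 - B)) + a * c * (1 - b) * (1 - (A * B + A * C + B * C) + 2 * (A * B * C))
        + a * c * (1 - b) * (A * C * (1 - B)))
    (hw₃ : w₃ = (1 - (a * b + a * c + b * c) + 2 * (a * b * c)) * (B * C * (1 - A)) + b * c * (1 - a) * (1 - (A * B + A * C + B * C) + 2 * (A * B * C))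
        + b * c * (1 - a) * (B * C * (1 - A)))
    (htw : tw = a * b * c * ((1 - (A * B + A * C + B * C) + 2 * (A * B * C)) + A * B * (1 - C) + A * C * (1 - B) + B * C * (1 - A) + A * B * C)
        + A * B * C * ((1 - (a * b + a * c + b * c) + 2 * (a * b * c)) + a * b * (1 - c) + a * c * (1 - b) + b * c * (1 - a))
       
        + (a * b * (1 - c) * (A * C * (1 - B) + B * C * (1 - A)) + a * c * (1 - b) * (A * B * (1 - C) + B * C * (1 - A))
        + b * c * (1 - a) * (A * B * (1 - C) + A * C * (1 - B))))
    (hqz : qz = 1 - ((a + A - a * A) * (b + B - b * B) + (a + A - a * A) * (c + C - c * C) + (b + B - b * B) * (c + C - c * C)) + 2 * ((a + A - a * A) * (b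
        + B - b * B) * (c + C - c * C)))
    (hz₁ : z₁ = (a + A - a * A) * (b + B - b * B) * (1 - (c + C - c * C)))
    (hz₂ : z₂ = (a + A - a * A) * (c + C - c * C) * (1 - (b + B - b * B)))
    (hz₃ : z₃ = (b + B - b * B) * (c + C - c * C) * (1 - (a + A - a * A)))
    (htz : tz = (a + A - a * A) * (b + B - b * B) * (c + C - c * C))
    (hq : q = (1 - p) * qw + p * qz) (hu₁ : u₁ = (1 - p) * w₁ + p * z₁) (hu₂ : u₂ = (1 - p) * w₂ + p * z₂)
    (hu₃ : u₃ = (1 - p) * w₃ + p * z₃) (ht : t = (1 - p) * tw + p * tz) :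
    0 ≤ AG q u₁ u₂ u₃ t := by
  have hqw' : qw = ((1 - a) * (1 - b) * (1 - c) + a * (1 - b) * (1 - c) + (1 - a) * b * (1 - c)
      + (1 - a) * (1 - b) * c) * ((1 - A) * (1 - B) * (1 - C) + A * (1 - B) * (1 - C) + (1 - A) * B * (1 - C) + (1 - A) * (1 - B) * C) := by
    rw [hqw]; ring
  have hw₁' : w₁ = ((1 - a) * (1 - b) * (1 - c) + a * (1 - b) * (1 - c) + (1 - a) * b * (1 - c) + (1 - a) * (1 - b) * c) * (A * B * (1 - C))
      + a * b * (1 - c) * ((1 - A) * (1 - B) * (1 - C) + A * (1 - B) * (1 - C) + (1 - A) * B * (1 - C) + (1 - A) * (1 - B) * C)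
      + a * b * (1 - c) * (A * B * (1 - C)) := by
    rw [hw₁]; ring
  have hw₂' : w₂ = ((1 - a) * (1 - b) * (1 - c) + a * (1 - b) * (1 - c) + (1 - a) * b * (1 - c) + (1 - a) * (1 - b) * c) * (A * C * (1 - B))
      + a * c * (1 - b) * ((1 - A) * (1 - B) * (1 - C) + A * (1 - B) * (1 - C) + (1 - A) * B * (1 - C) + (1 - A) * (1 - B) * C)
      + a * c * (1 - b) * (A * C * (1 - B)) := by
    rw [hw₂]; ring
  have hw₃' : w₃ = ((1 - a) * (1 - b) * (1 - c) + a * (1 - b) * (1 - c) + (1 - a) * b * (1 - c) + (1 - a) * (1 - b) * c) * (B * C * (1 - A))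
      + b * c * (1 - a) * ((1 - A) * (1 - B) * (1 - C) + A * (1 - B) * (1 - C) + (1 - A) * B * (1 - C) + (1 - A) * (1 - B) * C)
      + b * c * (1 - a) * (B * C * (1 - A)) := by
    rw [hw₃]; ring
  have htw' : tw = a * b * c * (((1 - A) * (1 - B) * (1 - C) + A * (1 - B) * (1 - C) + (1 - A) * B * (1 - C) + (1 - A) * (1 - B) * C)
      + A * B * (1 - C) + A * C * (1 - B) + B * C * (1 - A) + A * B * C) + A * B * C * (((1 - a) * (1 - b) * (1 - c)
      + a * (1 - b) * (1 - c) + (1 - a) * b * (1 - c) + (1 - a) * (1 - b) * c) + a * b * (1 - c) + a * c * (1 - b)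
      + b * c * (1 - a))
        + (a * b * (1 - c) * (A * C * (1 - B) + B * C * (1 - A)) + a * c * (1 - b) * (A * B * (1 - C)
      + B * C * (1 - A)) + b * c * (1 - a) * (A * B * (1 - C) + A * C * (1 - B))) := by
    rw [htw]; ring
  have hqz' : qz = (((1 - a) * (1 - A)) * ((1 - b) * (1 - B)) * ((1 - c) * (1 - C)) + (a * A + a * (1 - A)
      + (1 - a) * A) * ((1 - b) * (1 - B)) * ((1 - c) * (1 - C)) + ((1 - a) * (1 - A)) * (b * B + b * (1 - B)
      + (1 - b) * B) * ((1 - c) * (1 - C)) + ((1 - a) * (1 - A)) * ((1 - b) * (1 - B)) * (c * C + c * (1 - C) + (1 - c) * C)) := by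
    rw [hqz]; ring
  have hz₁' : z₁ = (a * A + a * (1 - A) + (1 - a) * A) * (b * B + b * (1 - B) + (1 - b) * B) * ((1 - c) * (1 - C)) := by
    rw [hz₁]; ring
  have hz₂' : z₂ = (a * A + a * (1 - A) + (1 - a) * A) * (c * C + c * (1 - C) + (1 - c) * C) * ((1 - b) * (1 - B)) := by
    rw [hz₂]; ring
  have hz₃' : z₃ = (b * B + b * (1 - B) + (1 - b) * B) * (c * C + c * (1 - C) + (1 - c) * C) * ((1 - a) * (1 - A)) := by
    rw [hz₃]; ring
  have htz' : tz = (a * A + a * (1 - A) + (1 - a) * A) * (b * B + b * (1 - B) + (1 - b) * B) * (c * C + c * (1 - C) + (1 - c) * C) := by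
    rw [htz]; ring
  rw [hubEdge_AG hqw' hw₁' hw₂' hw₃' htw' rfl rfl rfl rfl rfl rfl hqz' hz₁' hz₂' hz₃' htz' hq hu₁ hu₂ hu₃ ht]
  set p' := 1 - p with hp
  set a' := 1 - a with ha
  set b' := 1 - b with hb
  set c' := 1 - c with hc
  set A' := 1 - A with hA
  set B' := 1 - B with hB
  set C' := 1 - C with hC
  have hp' : 0 ≤ p' := by linarith
  have ha' : 0 ≤ a' := by linarith
  have hb' : 0 ≤ b' := by linarith
  have hc' : 0 ≤ c' := by linarith
  have hA' : 0 ≤ A' := by linarith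
  have hB' : 0 ≤ B' := by linarith
  have hC' : 0 ≤ C' := by linarith
  positivity

/-- Bernstein form of a cubic along a segment of cell vectors, for `Ha`: with `v = z − w`,
`Ha((1−p)w + pz) = (1−p)³Ha(w) + p(1−p)²(3Ha(w) + ∇Ha(w)·v) + p²(1−p)(3Ha(z) − ∇Ha(z)·v) + p³Ha(z)`. [folklore] -/
theorem Ha_segment_bernstein (p qw w₁ w₂ w₃ tw qz z₁ z₂ z₃ tz : ℝ) :
    Ha ((1 - p) * qw + p * qz) ((1 - p) * w₁ + p * z₁) ((1 - p) * w₂ + p * z₂) ((1 - p) * w₃ + p * z₃) ((1 - p) * tw + p * tz)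
    = (1 - p) ^ 3 * Ha qw w₁ w₂ w₃ tw
      + p * (1 - p) ^ 2 * (3 * Ha qw w₁ w₂ w₃ tw + (tw * tw * (qz - qw) + (2 * qw * tw - (w₁ * w₂ + w₁ * w₃ + w₂ * w₃)) * (tz - tw) - (tw * (w₂ + w₃) + w₂ * w₃) * (z₁ - w₁)
        - (tw * (w₁ + w₃) + w₁ * w₃) * (z₂ - w₂) - (tw * (w₁ + w₂) + w₁ * w₂) * (z₃ - w₃)))
      + p ^ 2 * (1 - p) * (3 * Ha qz z₁ z₂ z₃ tz - (tz * tz * (qz - qw) + (2 * qz * tz - (z₁ * z₂ + z₁ * z₃ + z₂ * z₃)) * (tz - tw) - (tz * (z₂ + z₃) + z₂ * z₃) * (z₁ - w₁)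
        - (tz * (z₁ + z₃) + z₁ * z₃) * (z₂ - w₂) - (tz * (z₁ + z₂) + z₁ * z₂) * (z₃ - w₃)))
      + p ^ 3 * Ha qz z₁ z₂ z₃ tz := by
  simp only [Ha]; ring

/-- The same Bernstein form for `Hb`. [folklore] -/
theorem Hb_segment_bernstein (p qw w₁ w₂ w₃ tw qz z₁ z₂ z₃ tz : ℝ) :
    Hb ((1 - p) * qw + p * qz) ((1 - p) * w₁ + p * z₁) ((1 - p) * w₂ + p * z₂) ((1 - p) * w₃ + p * z₃) ((1 - p) * tw + p * tz)
    = (1 - p) ^ 3 * Hb qw w₁ w₂ w₃ tw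
      + p * (1 - p) ^ 2 * (3 * Hb qw w₁ w₂ w₃ tw + ((2 * qw * tw - (w₁ * w₂ + w₁ * w₃ + w₂ * w₃)) * (qz - qw) + qw * qw * (tz - tw) - (qw * (w₂ + w₃) + w₂ * w₃) * (z₁ - w₁)
        - (qw * (w₁ + w₃) + w₁ * w₃) * (z₂ - w₂) - (qw * (w₁ + w₂) + w₁ * w₂) * (z₃ - w₃)))
      + p ^ 2 * (1 - p) * (3 * Hb qz z₁ z₂ z₃ tz - ((2 * qz * tz - (z₁ * z₂ + z₁ * z₃ + z₂ * z₃)) * (qz - qw) + qz * qz * (tz - tw) - (qz * (z₂ + z₃) + z₂ * z₃) * (z₁ - w₁)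
        - (qz * (z₁ + z₃) + z₁ * z₃) * (z₂ - w₂) - (qz * (z₁ + z₂) + z₁ * z₂) * (z₃ - w₃)))
      + p ^ 3 * Hb qz z₁ z₂ z₃ tz := by
  simp only [Hb]; ring

/-- Recombination of certified Bernstein pieces with a two-piece multiplier `((1−p)δ₀ + pδ₁)·((1−p)S₀ + pS₁)`. [folklore] -/
theorem segment_recombine (p HW GW HZ GZ δ₀ δ₁ S₀ S₁ : ℝ) :
    (1 - p) ^ 3 * HW + p * (1 - p) ^ 2 * (3 * HW + GW) + p ^ 2 * (1 - p) * (3 * HZ - GZ) + p ^ 3 * HZ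
    = (1 - p) ^ 3 * (HW - δ₀ * S₀) + p * (1 - p) ^ 2 * (3 * HW + GW - δ₀ * S₁ - δ₁ * S₀)
      + p ^ 2 * (1 - p) * (3 * HZ - GZ - δ₁ * S₁) + p ^ 3 * HZ
      + (1 - p) * ((1 - p) * δ₀ + p * δ₁) * ((1 - p) * S₀ + p * S₁) := by
  ring

/-- The same with a three-piece multiplier `(1−p)²S₀ + p(1−p)S₁ + p²S₂` (used on the `Hb` side, where the top piece `Hb(z)` is itself a
multiple of `q − t`). [folklore] -/
theorem segment_recombine₃ (p HW GW HZ GZ δ₀ δ₁ S₀ S₁ S₂ : ℝ) :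
    (1 - p) ^ 3 * HW + p * (1 - p) ^ 2 * (3 * HW + GW) + p ^ 2 * (1 - p) * (3 * HZ - GZ) + p ^ 3 * HZ
    = (1 - p) ^ 3 * (HW - δ₀ * S₀) + p * (1 - p) ^ 2 * (3 * HW + GW - δ₀ * S₁ - δ₁ * S₀)
      + p ^ 2 * (1 - p) * (3 * HZ - GZ - δ₀ * S₂ - δ₁ * S₁) + p ^ 3 * (HZ - δ₁ * S₂)
      + ((1 - p) * δ₀ + p * δ₁) * ((1 - p) ^ 2 * S₀ + p * (1 - p) * S₁ + p ^ 2 * S₂) := by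
  ring

end CubicThreePointHub

end Summit.CriticalPhenomena.PercolationContinuityZ3.Theorems
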